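import Literature.AnabelianGeometry.EtaleTheta.Discharge.Sec3Thm37Standard
import Literature.AlgebraicGeometry.Frobenioids.BiratFrobeniusCompactCriterion
import Literature.AlgebraicGeometry.Frobenioids.ModelFrobenioidPhiBirat
import Literature.AlgebraicGeometry.Frobenioids.Prop55SubRatStdSlot
import HarnessLib

/-!
# [EtTh] Theorem 3.7 (ii), second clause — "if, moreover, `Φ` is rational, then `C` is of RATIONALLY standard
# type" — DISCHARGED at the canonical [FrdI] vocabulary and THE [FrdI] Def. 4.5 parameters, modulo the
# printed input "`Π^tp_X` acts trivially on `K^×/O_K^×`"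

S. Mochizuki, *The étale theta function and its Frobenioid-theoretic manifestations*, Publ. RIMS **45**
(2009) [EtTh], §3, Theorem 3.7 (ii), p. 79 = PDF p. 305 ll. 33–34 of `paper:doi-10-2977-prims-1234361159`
[cite: MochizukiEtTh2009, Thm 3.7 (ii) p.79]:

> "(ii) Suppose `D` is of FSMFF-type, and that `Φ` is non-dilating. Then `C` is of standard type. If,
> moreover, `Φ` is rational [cf. Definition 3.6, (ii)], then `C` is of rationally standard type."

with proof, PDF p. 306 ll. 13–17: "As for assertion (ii), let us first observe that since `Π^tp_X` acts
trivially on `K^×/O_K^×`, it follows [cf. also the condition imposed on `F` in Definition 3.6, (ii), (b)] that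
every object of `(C^un-tr)^birat` is Frobenius-compact. Thus, assertion (ii) follows immediately from the
definitions" — i.e. from [FrdI] Thm 5.2 (iii), second sentence ("`C` is of rationally standard type iff (a) `C`
is of rational and standard type; (b) `(C^un-tr)^birat` admits a Frobenius-compact object"), and Def. 3.6 (ii),
last sentence (PDF p. 303): "If `C` is of rational … type [a property which is completely determined by `Φ` — cf.
[FrdI], Definition 4.5, (ii)], then we shall say that `Φ` is rational".

Proof-only sequel (theorems only, no definitions; cell abc-iut, node `EtTh:Thm3.7(ii)`, seat abc-iut-w5-d250) of
`Discharge/Sec3Thm37Standard.lean` (abc-iut-w4-d103), whose module docstring left this clause "NOT touched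
(schema) … no closed instance to be proved at yet". The closed instance now exists on the [FrdI] side: THE
parameters `PreFrobenioid.rsParams` (THE birationalizations / unit-trivialization, `Prop55Sub.lean`) with THE
support `PrimarySupp` of [FrdI] Def. 2.4 (i)(d) (`Prop55SubRatStdSlot.lean`), the identification
`Φ^birat = Div_B(B)` for model Frobenioids (`ModelFrobenioid.mem_biratSubgroup_iff_exists_divB`, abc-iut-L6-t10) and
the criterion "ONE non-torsion, pull-back-invariant rational-function divisor at an object of `C^un-tr` ⟹
`(C^un-tr)^birat` admits a Frobenius-compact object" (`Birat.exists_isFrobeniusCompact_untrBirat_of_invariant`,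
abc-iut-L6-t10). Contents, at the canonical vocabulary `treeCatVocab` (the context of `Sec3Thm37Standard`):

* `exists_isFrobeniusCompact_untrBirat_treeCatVocab (hBmon) (A) (hKfix)` — print's step: at `A ∈ Ob(D)`, the
  constant `b ∈ F(A)` with nonzero divisor `d₀ = x − y` of Def. 3.6 (ii)(b) (`exists_FΛ_div_ne`) gives a
  non-torsion (`Φ(A)` sharp, integral, saturated) element of `Φ^birat(A) = Div_B(B(A))`, invariant under the
  pull-backs along the automorphisms of `A` in `D` by the hypothesis `hKfix` ("`Π^tp_X` acts trivially on
  `K^×/O_K^×`": the divisors of CONSTANT rational functions are fixed) — so the object `(A, 0)` of `C` (isotropic: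
  every object of a model Frobenioid is) yields a Frobenius-compact object of `(C^un-tr)^birat`;
* **`thm37_ii_ratStd_treeCatVocab (hBmon) (hD) (hnd) (hrat) (A) (hKfix)`** — the second clause: `C` is of
  rationally standard type at THE parameters, given `hBmon` ([FrdI] Thm 5.2 preamble "`B` a monoid on `D`", as in
  `Sec3Thm37Standard`), `D` of FSMFF-type and `Φ` non-dilating (the first clause's inputs), "`Φ` rational" at
  THE support (`hrat`: every object rational, [FrdI] Def. 4.5 (ii) — Def. 3.6 (ii)'s DEFINITION of "`Φ`
  rational"), and `hKfix` at one object `A`. [FrdI] Def. 4.5 (iii) field by field: birationally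
  Frobenius-normalized (`isOfBiratFrobeniusNormalizedType_treeCatVocab`, [FrdI] Thm 5.2 (ii)), rational (`hrat`),
  standard (`isOfStandardType_treeCatVocab`, the first clause), (b) (the previous item);
* `thm37_ii_ratStd_treeCatVocab'` — the same with `hKfix` at every object (`D` connected ⇒ nonempty).
The hypothesis `hKfix` is an INTERFACE-LEVEL datum (the abstract `RealifiedDivisorMonoids` / `TemperedFrobenioid`
over `D → D₀` records the stability `FΛ_map` of constants but not the triviality of the `Aut_D(A)`-action on their
divisors; cell GAP-LEDGER row G-w5d250-1) — stated as an explicit binder with its printed locator, not as a new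
`Prop` fact. HONEST FRAMING: refereed pre-IUT material ([EtTh] §3 over [FrdI] §4–§5); nothing here bears on
[IUTchIII] Cor. 3.12; no statement of either paper is strengthened; typed ≠ proved — here PROVED modulo the
named inputs.
-/

namespace Literature.AnabelianGeometry.EtaleTheta

open CategoryTheory Opposite Literature.AlgebraicGeometry.Frobenioids

universe u₀ v₀ u v w

variable {D₀ : Type u₀} [Category.{v₀} D₀] {V : FrdIMonoidStub.{w}}
  {T : RealifiedDivisorMonoids (D₀ := D₀) V} {D : Type u} [Category.{v} D]

namespace TemperedFrobenioid

section TreeVocab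

variable {IsRational IsStrictlyRational : (Dᵒᵖ ⥤ CommMonCat.{w}) → Prop}
  (C₀ : TemperedFrobenioid T D (treeCatVocab D IsRational IsStrictlyRational))

/-- **"Every object of `(C^un-tr)^birat` is Frobenius-compact" — the instance print uses** (proof of
Thm 3.7 (ii), PRIMS p. 306: "since `Π^tp_X` acts trivially on `K^×/O_K^×`, it follows [cf. also the
condition imposed on `F` in Definition 3.6, (ii), (b)] that every object of `(C^un-tr)^birat` is
Frobenius-compact"): at an object `A ∈ Ob(D)`, the constant rational function `b ∈ F(A)` with NONZERO divisor
`d₀ = Div(b)` supplied by Def. 3.6 (ii)(b) (`exists_FΛ_div_ne`) is a non-torsion element of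
`Φ^birat(A) = Div_B(B(A))` ([FrdI] Thm 5.2 (ii) "Moreover", abc-iut-L6-t10's
`ModelFrobenioid.mem_biratSubgroup_iff_exists_divB`); GIVEN that its divisor is invariant under the
pull-backs along the automorphisms of `A` in `D` (hypothesis `hKfix` — print's "`Π^tp_X` acts trivially on
`K^×/O_K^×`", which the abstract interface `RealifiedDivisorMonoids` / `TemperedFrobenioid` does not carry),
abc-iut-L6-t10's criterion `Birat.exists_isFrobeniusCompact_untrBirat_of_invariant` ([FrdI] Def. 4.5 (iii)(b)
from ONE invariant non-torsion rational-function divisor) yields a Frobenius-compact object of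
`(C^un-tr)^birat` over `A`. [cite: MochizukiEtTh2009, Thm 3.7 (ii) p.79] -/
theorem exists_isFrobeniusCompact_untrBirat_treeCatVocab (hBmon : IsMonoidOn C₀.ratFnFunctor) (A : D)
    (hKfix : ∀ (f : A ≅ A) (b : T.BΛ.obj (C₀.baseOp (op A)))
      (ξ : Algebra.GrothendieckGroup (C₀.Φ.carrier (op A))),
      b ∈ T.FΛ (C₀.baseOp (op A)) → (b, ξ) ∈ C₀.ratFn (op A) → pullGp C₀.divisorMonoid f.hom ξ = ξ) :
    ∃ Y : PreFrobenioid.Birat (PreFrobenioid.untrFunctor (C₀.isFrobenioid_treeCatVocab_of_isMonoidOn hBmon))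
        (PreFrobenioid.isFrobenioid_untr (C₀.isFrobenioid_treeCatVocab_of_isMonoidOn hBmon))
        (PreFrobenioid.hasBiratSquares_untr (C₀.isFrobenioid_treeCatVocab_of_isMonoidOn hBmon)),
      (PreFrobenioid.biratOps
          (PreFrobenioid.isFrobenioid_untr (C₀.isFrobenioid_treeCatVocab_of_isMonoidOn hBmon))
          (PreFrobenioid.hasBiratSquares_untr (C₀.isFrobenioid_treeCatVocab_of_isMonoidOn hBmon))).IsFrobeniusCompact
        Y := by
  have hF := C₀.isFrobenioid_treeCatVocab_of_isMonoidOn hBmon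
  have hBg := C₀.ratFnFunctor_isGroupLike_holds
  have hΦd := C₀.isDivisorial_divisorMonoid
  -- the object `(A, 0)` of the tempered (model) Frobenioid, isotropic, as an object of `C^un-tr`
  let X₀ : C₀.category := ⟨A, 1⟩
  have hX₀ : (PreFrobenioidData.ofFunctor C₀.divisorMonoid C₀.toElem).IsIsotropic X₀ :=
    (PreFrobenioidData.ofFunctor_isIsotropic C₀.toElem X₀).mpr (ModelFrobenioid.isIsotropic hBg X₀)
  let A' : (PreFrobenioidData.ofFunctor C₀.divisorMonoid C₀.toElem).Untr := { as := ⟨X₀, hX₀⟩ }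
  -- the constant rational function of Def. 3.6 (ii)(b) and its nonzero divisor `d₀ = x − y`
  obtain ⟨b, hb, x, hx, y, hy, hxy, hdiv⟩ := C₀.exists_FΛ_div_ne (op A)
  let d₀ : Algebra.GrothendieckGroup (C₀.Φ.carrier (op A)) :=
    Algebra.GrothendieckGroup.of ⟨x, hx⟩ / Algebra.GrothendieckGroup.of ⟨y, hy⟩
  have hbd : (b, d₀) ∈ C₀.ratFn (op A) := by
    change T.divΛ (C₀.baseOp (op A)) b = C₀.ΦgpToRlog (op A) d₀
    rw [hdiv, ΦgpToRlog, map_div, gpMap_of, gpMap_of]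
    rfl
  -- `d₀ ∈ Φ^birat(A) = Div_B(B(A))`
  have hd₀ : d₀ ∈ PreFrobenioid.biratSubgroup C₀.toElem
      (PreFrobenioid.baseObj (PreFrobenioid.untrFunctor hF) A') :=
    (ModelFrobenioid.mem_biratSubgroup_iff_exists_divB hBg hΦd hF X₀ d₀).mpr ⟨⟨(b, d₀), hbd⟩, rfl⟩
  -- `d₀` is non-torsion: `x ≠ y` in the sharp, integral, saturated `Φ(A)`
  have htors : ∀ N : ℕ, 0 < N → d₀ ^ N ≠ 1 := by
    intro N hN h
    have hΦA : IsDivisorial (C₀.Φ.carrier (op A)) := hΦd A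
    haveI : IsCancelMul (C₀.Φ.carrier (op A)) := isIntegral_iff_isCancelMul.mp hΦA.isPreDivisorial.isIntegral
    have h' : Algebra.GrothendieckGroup.of ((⟨x, hx⟩ : C₀.Φ.carrier (op A)) ^ N) =
        Algebra.GrothendieckGroup.of ((⟨y, hy⟩ : C₀.Φ.carrier (op A)) ^ N) := by
      rw [map_pow, map_pow, ← div_eq_one, ← div_pow]
      exact h
    have hN' : ((⟨x, hx⟩ : C₀.Φ.carrier (op A)) ^ N) = ⟨y, hy⟩ ^ N := Algebra.GrothendieckGroup.of_injective h'
    have hxy' : (⟨x, hx⟩ : C₀.Φ.carrier (op A)) = ⟨y, hy⟩ :=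
      of_injective_of_isSharp_isIntegral_isSaturated hΦA.isSharp hΦA.isPreDivisorial.isIntegral
        hΦA.isPreDivisorial.isSaturated (Perfection.of_eq_of_iff.mpr ⟨⟨N, hN⟩, hN'⟩)
    exact hxy (congrArg Subtype.val hxy')
  -- invariance under the base maps of the automorphisms of `(A′)^birat`
  have hinv : ∀ f : Aut ((PreFrobenioid.toBirat (PreFrobenioid.untrFunctor hF)
      (PreFrobenioid.isFrobenioid_untr hF) (PreFrobenioid.hasBiratSquares_untr hF)).obj A'),
      pullGp C₀.divisorMonoid (PreFrobenioid.Birat.gpBase f.inv) d₀ = d₀ :=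
    fun f => hKfix ⟨PreFrobenioid.Birat.gpBase f.inv, PreFrobenioid.Birat.gpBase f.hom,
      PreFrobenioid.BiratUnits.gpBase_inv_comp_hom f, PreFrobenioid.BiratUnits.gpBase_hom_comp_inv f⟩ b d₀ hb hbd
  exact PreFrobenioid.Birat.exists_isFrobeniusCompact_untrBirat_of_invariant hF A' d₀ hd₀ htors hinv

/-- **[EtTh] Thm 3.7 (ii), second clause, at the canonical vocabulary and THE [FrdI] Def. 4.5 parameters**:
"If, moreover, `Φ` is rational [cf. Definition 3.6, (ii): '`Φ` rational' MEANS '`C` of rational type',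
[FrdI] Def. 4.5 (ii)], then `C` is of rationally standard type" — for the tempered Frobenioid `C` (the model
Frobenioid of `(D, Φ, B, B → Φ^gp)`), given `hBmon` ([FrdI] Thm 5.2 preamble), `D` of FSMFF-type and `Φ`
non-dilating (first clause, abc-iut-w4-d103's `isOfStandardType_treeCatVocab`), "`Φ` rational" at THE support
`PrimarySupp` (`hrat`), and the invariance of the divisors of constants at one object (`hKfix`, print p. 306
"`Π^tp_X` acts trivially on `K^×/O_K^×`"): `C` is of rationally standard type ([FrdI] Def. 4.5 (iii) at
`PreFrobenioid.rsParams`: birationally Frobenius-normalized — [FrdI] Thm 5.2 (ii), `isOfBiratFrobeniusNormalizedType_treeCatVocab`;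
rational — `hrat`; standard — first clause; (b) — `exists_isFrobeniusCompact_untrBirat_treeCatVocab`), i.e.
[FrdI] Thm 5.2 (iii), second sentence, read right to left. [cite: MochizukiEtTh2009, Thm 3.7 (ii) p.79] -/
theorem thm37_ii_ratStd_treeCatVocab (hBmon : IsMonoidOn C₀.ratFnFunctor) (hD : IsOfFSMFFType D)
    (hnd : IsNonDilatingOn C₀.divisorMonoid)
    (hrat : ∀ X : C₀.category,
      PreFrobenioidData.IsRational
        (PreFrobenioid.biratData (C₀.isFrobenioid_treeCatVocab_of_isMonoidOn hBmon)
          (PreFrobenioid.hasBiratSquares_of_isFrobenioid (C₀.isFrobenioid_treeCatVocab_of_isMonoidOn hBmon)))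
        (S := PreFrobenioidData.ofFunctor C₀.divisorMonoid C₀.toElem) (fun a 𝔭 => PrimarySupp a 𝔭) X)
    (A : D)
    (hKfix : ∀ (f : A ≅ A) (b : T.BΛ.obj (C₀.baseOp (op A)))
      (ξ : Algebra.GrothendieckGroup (C₀.Φ.carrier (op A))),
      b ∈ T.FΛ (C₀.baseOp (op A)) → (b, ξ) ∈ C₀.ratFn (op A) → pullGp C₀.divisorMonoid f.hom ξ = ξ) :
    (PreFrobenioidData.ofFunctor C₀.divisorMonoid C₀.toElem).IsOfRationallyStandardType
      (PreFrobenioid.rsParams (C₀.isFrobenioid_treeCatVocab_of_isMonoidOn hBmon) fun a 𝔭 => PrimarySupp a 𝔭) :=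
  { biratFrobNormalized := C₀.isOfBiratFrobeniusNormalizedType_treeCatVocab hBmon
    rational := hrat
    standard := C₀.isOfStandardType_treeCatVocab hBmon hD hnd
    frobCompact := C₀.exists_isFrobeniusCompact_untrBirat_treeCatVocab hBmon A hKfix }

/-- **The same with the invariance hypothesis at EVERY object** (the form print states: "`Π^tp_X` acts trivially
on `K^×/O_K^×`" globally); `D` is connected, hence nonempty, so some object carries the Frobenius-compact witness.
[cite: MochizukiEtTh2009, Thm 3.7 (ii) p.79] -/
theorem thm37_ii_ratStd_treeCatVocab' (hBmon : IsMonoidOn C₀.ratFnFunctor) (hD : IsOfFSMFFType D)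
    (hnd : IsNonDilatingOn C₀.divisorMonoid)
    (hrat : ∀ X : C₀.category,
      PreFrobenioidData.IsRational
        (PreFrobenioid.biratData (C₀.isFrobenioid_treeCatVocab_of_isMonoidOn hBmon)
          (PreFrobenioid.hasBiratSquares_of_isFrobenioid (C₀.isFrobenioid_treeCatVocab_of_isMonoidOn hBmon)))
        (S := PreFrobenioidData.ofFunctor C₀.divisorMonoid C₀.toElem) (fun a 𝔭 => PrimarySupp a 𝔭) X)
    (hKfix : ∀ (A : D) (f : A ≅ A) (b : T.BΛ.obj (C₀.baseOp (op A)))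
      (ξ : Algebra.GrothendieckGroup (C₀.Φ.carrier (op A))),
      b ∈ T.FΛ (C₀.baseOp (op A)) → (b, ξ) ∈ C₀.ratFn (op A) → pullGp C₀.divisorMonoid f.hom ξ = ξ) :
    (PreFrobenioidData.ofFunctor C₀.divisorMonoid C₀.toElem).IsOfRationallyStandardType
      (PreFrobenioid.rsParams (C₀.isFrobenioid_treeCatVocab_of_isMonoidOn hBmon) fun a 𝔭 => PrimarySupp a 𝔭) := by
  haveI := C₀.isConnected
  obtain ⟨A⟩ := (inferInstance : IsConnected D).is_nonempty
  exact C₀.thm37_ii_ratStd_treeCatVocab hBmon hD hnd hrat A (hKfix A)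

end TreeVocab

end TemperedFrobenioid

end Literature.AnabelianGeometry.EtaleTheta
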